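import Summits.BirchSwinnertonDyer.BirchSwinnertonDyer.Theorems.SignedLowerHalvesSprungLowerDivisibilityAtThreeKatoFineSporadic
import Summits.BirchSwinnertonDyer.BirchSwinnertonDyer.Theses.PrintX8VS
import HarnessLib

/-!
# Crux `SprungLowerDivisibilityAtThree` (item stmt-BirchSwinnertonDyer-19875) on route `PrintX8VS` (split gen 1, rev 8):
# the v7 glue for the `PrintX8VS` copy of K1 — `K1 ⟸ K_spor ∧ C2 ∧ C4` (no C3, no C1)

Cell `bsd-ssimc` (host) / lead `cruxlead-stmt-BirchSwinnertonDyer-19875` (g2); `--supports` 19875 `--as helper`. This is the `PrintX8VS` copy of the v7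
glue landed for route `SignedLowerHalves` in `…KatoFineSporadic.lean` (p614828): from the colour-free Kato fine lower bound at the sporadic
common zeros (`hKsp`, = registered v7 stub `stub_katoFineLowerSporadic`; the x8 SPLIT-v7 candidate child C1' `KatoFineLowerBoundSporadicX8`),
C2 and C4 — showing in the kernel that the child C3 (Sprung 2017 Conj. 4.12) is NOT needed for K1 once C1 is replaced by C1'.
C1, C2, C3 are OPEN cruxes, C4 is HELD; K1 / BSD / leaf X8 are NOT proved by anything here.

References: [Sprung2012] Main Conj. 7.21 (p. 1505); [Sprung2015] Conj. 5.6; [Sprung2017] Conj. 4.12; [Kato2004Asterisque] Conj. 12.10 (p. 224);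
tree `…KatoFineSporadic` (p614828), `Theses/PrintX8VS.lean` rev 8.
-/

set_option linter.dupNamespace false
set_option autoImplicit false

noncomputable section

open scoped Classical NumberField MatrixGroups ModularForm

open NumberField IsDedekindDomain CongruenceSubgroup WeierstrassCurve Field
  Literature.NumberTheory.EllipticCurves Literature.NumberTheory.EllipticCurves.ModularForms
  Literature.NumberTheory.EllipticCurves.ZpExtension Literature.NumberTheory.EllipticCurves.Sprung2017
  Literature.NumberTheory.EllipticCurves.Sprung2012 Literature.NumberTheory.EllipticCurves.Rank1Residual
  Literature.NumberTheory.EllipticCurves.IwasawaAlgebra Literature.NumberTheory.EllipticCurves.Kato2004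
  Summit.BirchSwinnertonDyer.BirchSwinnertonDyer.Theorems

namespace Summit.BirchSwinnertonDyer.BirchSwinnertonDyer.Theorems.ChromaticCommonZeros

/-- **K1 (`PrintX8VS` copy) from C1' ∧ C2 ∧ C4**: `Theses.PrintX8VS.SprungLowerDivisibilityAtThree` BY NAME from the colour-free Kato
fine lower bound at the sporadic common zeros (`hKsp`, VERBATIM the registered v7 stub `stub_katoFineLowerSporadic`), the child
C2 `ChromaticCyclotomicLowerRestX8` and the held conjunction C4 `ChromaticHeldInputsX8` — by the landed v7 glue
`sprungSharpFlatLowerDivisibility_of_katoSporadic` (p614828). CONDITIONAL (displayed); closes nothing; records in the kernel that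
child C3 `ChromaticBothColoursPosRankX8` (Sprung 2017 Conj. 4.12) is unnecessary once C1 is replaced by C1'.
[cite: Kato2004Asterisque, Conj. 12.10 (p. 224)] [cite: Sprung2012, Main Conj. 7.21 (p. 1505)] -/
theorem sprungLowerDivisibilityAtThree_printX8VS_of_katoSporadic
    (hKsp :
      ∀ (W : WeierstrassCurve ℚ) [W.IsElliptic] [W.IsGloballyMinimal] (p : ℕ) [Fact p.Prime]
        [ContinuousSMul ℤ_[p] (W.tateModule p)] [Module.Free ℤ_[p] (W.tateModule p)]
        [Module.Finite ℤ_[p] (W.tateModule p)],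
        ClassX8 W p → ∀ (κ : ZpExtension ℚ p) (γ : Field.absoluteGaloisGroup ℚ),
        κ.IsCyclotomic → κ.IsTopGenerator γ → IsCyclotomicVariable p γ →
      ∀ (v : HeightOneSpectrum (𝓞 ℚ)), (p : 𝓞 ℚ) ∈ v.asIdeal →
      ∀ (g : Field.absoluteGaloisGroup (v.adicCompletion ℚ)),
        κ.IsTopGenerator (resGalOfEmb (closureEmb (K := ℚ) (v.adicCompletion ℚ)) g) →
      ∀ (cneg : localPoints W (v.adicCompletion ℚ)) (c : ℕ → localPoints W (v.adicCompletion ℚ)),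
        IsHondaSystem κ (closureEmb (K := ℚ) (v.adicCompletion ℚ)) W (W.frobeniusTrace p) g cneg c →
      ∀ (N : ℕ) (_ : NeZero N) (f : CuspForm (Gamma0 N) 2) (ϖ : ℚ) (Lsharp Lflat : IwasawaAlgebra p),
        IsNewformOf W f → (ϖ : ℝ) * W.realPeriodRat = plusPeriod f →
        IsSprungPair f p (W.frobeniusTrace p) Lsharp Lflat →
      ∀ (I : Kato2004.IwasawaH1Data W p κ γ)
        (Cs : SharpFlatColemanKatoData W p f ϖ κ γ (closureEmb (K := ℚ) (v.adicCompletion ℚ))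
          (W.frobeniusTrace p) g c Chroma.sharp I)
        (Cf : SharpFlatColemanKatoData W p f ϖ κ γ (closureEmb (K := ℚ) (v.adicCompletion ℚ))
          (W.frobeniusTrace p) g c Chroma.flat I),
        Cs.Z = Cf.Z →
      ∀ (Y : W.FineSelmerDualData κ γ) (𝔭 : PrimeSpectrum (IwasawaAlgebra p)), 𝔭.asIdeal.height = 1 →
        (p : IwasawaAlgebra p) ∉ 𝔭.asIdeal →
        (¬ ∃ n : ℕ, ((cyclotomicOmega p n).map (Int.castRingHom ℤ_[p]) : PowerSeries ℤ_[p]) ∈ 𝔭.asIdeal) →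
        (∀ (col' : Chroma) (G' : IwasawaAlgebra p),
          iwasawaToPowerSeries p G' =
            PowerSeries.C (ϖ : ℚ_[p]) * iwasawaToPowerSeries p (chromaticL col' Lsharp Lflat) →
          G' ∈ 𝔭.asIdeal) →
        Module.lengthAt (IwasawaAlgebra p) (I.H ⧸ Cs.Z) 𝔭 ≤ Module.lengthAt (IwasawaAlgebra p) Y.X 𝔭)
    (hC2 : Summit.BirchSwinnertonDyer.BirchSwinnertonDyer.Theses.PrintX8VS.ChromaticCyclotomicLowerRestX8)
    (hC4 : Summit.BirchSwinnertonDyer.BirchSwinnertonDyer.Theses.PrintX8VS.ChromaticHeldInputsX8) :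
    Summit.BirchSwinnertonDyer.BirchSwinnertonDyer.Theses.PrintX8VS.SprungLowerDivisibilityAtThree :=
  fun W _ _ p _ hX col =>
    sprungSharpFlatLowerDivisibility_of_katoSporadic hKsp hC2 hC4.1 hC4.2.1 hC4.2.2.1 hC4.2.2.2.1 hC4.2.2.2.2 W p hX col

end Summit.BirchSwinnertonDyer.BirchSwinnertonDyer.Theorems.ChromaticCommonZeros

end
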